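import Mathlib
import HarnessLib
import Summits.Langlands.Langlands.Theses.G2ShadowRankSeven

/-!
# Birth skeleton (BC3) for crux stmt-Langlands-18290 — line `birth`
`Summit.Langlands.Langlands.Theses.G2ShadowRankSeven.GenericWeightCofinite`

THE CRUX (cell C of route G2ShadowRankSeven, rank 4). For every regular, L-algebraic cuspidal `π` on
`GL₇(𝔸_ℚ)` that is essentially self-dual at Satake level and whose infinity type is NOT
`G₂`-admissible (the seven `z`-exponents are not of the shape `{c, c ± p, c ± q, c ± (p+q)}`), there
is a finite set `S` of primes such that for `ℓ ∉ S`, every `ι : ℚ̄_ℓ ≃ ℂ` and every framed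
`ρ : Γ_ℚ → GL₇(ℚ̄_ℓ)` Satake–Frobenius compatible with `(π, ι)` at almost all places is irreducible
(Dai, arXiv:2510.12496 Thm 1.1, with the Lie type `G₂` excluded a priori by Sen's theorem:
the Hodge–Tate cocharacter lies in the algebraic monodromy group, doi:10.2307/1970879).

## The line (3 stubs + one proved linear-algebra step), re-typed by the skeleton registrar

Write `Hyp(π, T)` for the crux's standing hypotheses (infinity type `T`, regular, L-algebraic,
essentially self-dual at Satake level, `T` not `G₂`-admissible) and `Compat(ρ)` for
"`∀ᶠ v`, `SatakeFrobCompatibleAt ι π ρ v`".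

* `stub_semisimpleCompanionIrreducible` (M; framed semisimplification): every compatible framed
  `ρ` has a compatible SEMISIMPLE companion `ρ'` (its semisimplification in an adapted frame: same
  Frobenius characteristic polynomials, kernel ⊇ `ker ρ`, hence unramified wherever `ρ` is) with
  `ρ'` irreducible ⇒ `ρ` irreducible (an irreducible semisimplification has one Jordan–Hölder factor).
  Pure representation theory of profinite groups; no automorphic input.
* `stub_genericNoLine` (M–L; Dai §4.2 (i), with §3 and Sen): under `Hyp(π, T)`, cofinitely in
  `ℓ`, no compatible semisimple `ρ` has a ONE-dimensional subrepresentation. Dai's mechanism: fix a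
  Lie-irreducible `λ₀` (Patrikis–Taylor arXiv:1307.1640 = Dai Thm 3.1, and Dai Prop 3.2); by Sen
  (doi:10.2307/1970879: the Hodge–Tate cocharacter lies in the monodromy group) its Lie type is
  `B₃` — types `G₂` and `7A₁` force the `G₂`-admissible weight shape that `Hyp` excludes, `SL₇` is
  excluded by essential self-duality; if some `ρ_{λ₁} = φ ⊕ χ` is `6+1`, `GO₇`-valuedness puts `φ`
  in `GO₆`, Calegari–Gee (Dai Thm 2.13) makes `φ` essentially self-dual and odd, `SO₆` is of type A
  so `φ` is residually irreducible for `ℓ ≫ 0` (Hui doi:10.1112/jlms.12811 = Dai Thm 2.15 (iii)),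
  BLGGT (doi:10.4007/annals.2014.179.2.3 = Dai Thms 2.9/2.10) extends `φ` to a strictly compatible
  system and class field theory extends `χ`; `λ`-independence then makes `ρ_{λ₀}` reducible —
  contradiction.
* `stub_genericNoSmallPiece` (L; Dai §4.1, §4.2 (ii), with §3 and Sen): under `Hyp(π, T)`,
  cofinitely in `ℓ`, no compatible semisimple `ρ` has a subrepresentation of dimension 2 or 3. Dai's
  mechanism: such a piece `φ` is Lie-irreducible of type `SL₂` / `SO₃` (formal character), fits into
  a strictly compatible system (Hui, Dai Prop 2.12), and Goursat at the Lie-irreducible `λ₀` of type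
  `B₃` (as above) gives `ρ_{λ₀} ⊕ φ_{λ₀}` semisimple rank 4 against rank 3 at `λ₁`, contradicting
  `λ`-independence of the rank (Serre, Dai Thm 2.3).
* REDUCTION TO DAI'S SETTING (inside stubs 2–3): a semisimple framed `ρ` that is Satake–Frobenius
  compatible with `(π, ι)` at almost all `v` is — by Frobenius density
  (`Literature.NumberTheory.GaloisRepresentations.absoluteGaloisGroup.frobenius_dense`, from
  `Literature.NumberTheory.Automorphic.chebotarev_artinRep_holds`), continuity of `charpoly ∘ ρ`,
  and Brauer–Nesbitt (`Literature.NumberTheory.GaloisRepresentations.brauerNesbitt_holds`) —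
  isomorphic to an integral Tate twist of the automorphic `r_{ℓ,ι}(π)` of the named fact
  `Literature.NumberTheory.Automorphic.exists_galoisRep_of_regularAlgebraic` (`n = 7` is odd, so
  the L- versus C-algebraic half-twist `q_v^{(n-1)/2}` is integral); the finitely many exceptional `λ` of
  Dai Thm 1.1 lie over finitely many `ℓ`, which is the `Finset ℕ` of the stubs (every
  `ι : ℚ̄_ℓ ≃ ℂ` induces some `λ ∣ ℓ` of the coefficient field).
* PROVED here (`shapes_of_isSemisimple`, no `sorry`): a semisimple representation on a 7-dimensional
  space is irreducible or has a subrepresentation of dimension 1, 2 or 3 (a proper non-zero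
  subrepresentation or its complement has dimension ≤ 3). This was the registered stub
  `stub_genericShapes` of the route planner's skeleton; the skeleton vet (SKELVET.md, 2026-08-17)
  flagged it `stub.content-free`, so it is discharged in-file and is no longer a stub.

Composition `GenericWeightCofinite_of : companion → noLine → noSmallPiece → GenericWeightCofinite`
(kernel-checked, no `sorry` outside the three `stub_*`): take `S = S₁ ∪ S₂`; for `ℓ ∉ S` pass to the
semisimple companion, split by `shapes_of_isSemisimple`, kill the three reducible shapes with the two
stubs, and pull irreducibility back along the companion.

Disproof used: none exists (`ledger crux ls stmt-Langlands-18290`: no workfiles, no `Disproof.lean`,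
no `Negative/` lemma, 2026-08-17); `ledger negatives --problem Langlands` has no statement of the
stubs' shape. No `_false_without_` theorem to honour.
-/

-- `Summit.Langlands.Langlands.…` repeats a namespace component by design (D-0017 nested layout).
set_option linter.dupNamespace false
set_option linter.unusedVariables false

noncomputable section

namespace Summit.Langlands.Langlands.Cruxes.GenericWeightCofinite.Birth

open scoped MatrixGroups NumberField
open NumberField IsDedekindDomain Filter
open Literature.NumberTheory.Automorphic Literature.NumberTheory.GaloisRepresentations
open Summit.Langlands.Langlands.Theses.G2ShadowRankSeven

/-! ## 0. The linear-algebra step, PROVED (formerly the content-free stub `stub_genericShapes`) -/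

section Shapes

variable {k G V : Type*} [Field k] [Monoid G] [AddCommGroup V] [Module k V]

omit [Field k] in
/-- The bottom subrepresentation has underlying submodule `⊥`. [folklore] -/
theorem toSubmodule_bot' {k : Type*} [CommSemiring k] [Module k V] (ρ : Representation k G V) :
    (⊥ : Subrepresentation ρ).toSubmodule = ⊥ := rfl

omit [Field k] in
/-- The top subrepresentation has underlying submodule `⊤`. [folklore] -/
theorem toSubmodule_top' {k : Type*} [CommSemiring k] [Module k V] (ρ : Representation k G V) :
    (⊤ : Subrepresentation ρ).toSubmodule = ⊤ := rfl

/-- **Reducible shapes in dimension 7.** A semisimple representation on a 7-dimensional vector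
space is irreducible, or has a subrepresentation of dimension 1, 2 or 3: a proper non-zero
subrepresentation `W` has `1 ≤ dim W ≤ 6`, and if `dim W ≥ 4` a complement `W'` (semisimplicity)
has `dim W' = 7 - dim W ∈ {1, 2, 3}`. Pure linear algebra (the skeleton vet's `ShapesTrivial`).
[folklore] -/
theorem shapes_of_isSemisimple [FiniteDimensional k V] (ρ : Representation k G V)
    (h7 : Module.finrank k V = 7) (hss : ρ.IsSemisimpleRepresentation) :
    ρ.IsIrreducible ∨ (∃ W : Subrepresentation ρ, Module.finrank k W.toSubmodule = 1) ∨
      (∃ W : Subrepresentation ρ, Module.finrank k W.toSubmodule = 2) ∨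
      (∃ W : Subrepresentation ρ, Module.finrank k W.toSubmodule = 3) := by
  classical
  by_cases hirr : ρ.IsIrreducible
  · exact Or.inl hirr
  right
  -- the lattice of subrepresentations is non-trivial (`V ≠ 0`)
  have hV : Nontrivial V := Module.nontrivial_of_finrank_pos (R := k) (by omega)
  have hbt : (⊥ : Subrepresentation ρ) ≠ ⊤ := by
    intro h
    have h' : (⊥ : Subrepresentation ρ).toSubmodule = (⊤ : Subrepresentation ρ).toSubmodule := by
      rw [h]
    rw [toSubmodule_bot', toSubmodule_top'] at h'
    exact bot_ne_top h'
  haveI : Nontrivial (Subrepresentation ρ) := ⟨⟨⊥, ⊤, hbt⟩⟩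
  -- not irreducible ⇒ a proper non-zero subrepresentation
  have hW : ∃ W : Subrepresentation ρ, W ≠ ⊥ ∧ W ≠ ⊤ := by
    by_contra hcon
    push Not at hcon
    exact hirr ⟨fun W => (em (W = ⊥)).imp_right (hcon W)⟩
  obtain ⟨W, hWb, hWt⟩ := hW
  have h1 : Module.finrank k W.toSubmodule ≠ 0 := by
    intro h0
    apply hWb
    apply Subrepresentation.toSubmodule_injective
    rw [toSubmodule_bot']
    exact Submodule.finrank_eq_zero.mp h0
  have h2 : Module.finrank k W.toSubmodule < 7 := by
    rw [← h7]
    apply Submodule.finrank_lt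
    intro htop
    apply hWt
    apply Subrepresentation.toSubmodule_injective
    rw [toSubmodule_top']
    exact htop
  -- a complement, and the dimension count
  obtain ⟨W', hc⟩ := hss.exists_isCompl W
  have hinf : W.toSubmodule ⊓ W'.toSubmodule = ⊥ := by
    have h := congrArg Subrepresentation.toSubmodule hc.inf_eq_bot
    rwa [Subrepresentation.toSubmodule_inf, toSubmodule_bot'] at h
  have hsup : W.toSubmodule ⊔ W'.toSubmodule = ⊤ := by
    have h := congrArg Subrepresentation.toSubmodule hc.sup_eq_top
    rwa [Subrepresentation.toSubmodule_sup, toSubmodule_top'] at h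
  have hsum : Module.finrank k W.toSubmodule + Module.finrank k W'.toSubmodule = 7 := by
    have key := Submodule.finrank_sup_add_finrank_inf_eq W.toSubmodule W'.toSubmodule
    rw [hinf, hsup, finrank_top, finrank_bot, h7] at key
    omega
  have hcases : Module.finrank k W.toSubmodule = 1 ∨ Module.finrank k W.toSubmodule = 2 ∨
      Module.finrank k W.toSubmodule = 3 ∨ Module.finrank k W'.toSubmodule = 1 ∨
      Module.finrank k W'.toSubmodule = 2 ∨ Module.finrank k W'.toSubmodule = 3 := by
    omega
  rcases hcases with h | h | h | h | h | h
  · exact Or.inl ⟨W, h⟩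
  · exact Or.inr (Or.inl ⟨W, h⟩)
  · exact Or.inr (Or.inr ⟨W, h⟩)
  · exact Or.inl ⟨W', h⟩
  · exact Or.inr (Or.inl ⟨W', h⟩)
  · exact Or.inr (Or.inr ⟨W', h⟩)

end Shapes

/-! ## 1. The three stubs (`sorry` lives ONLY here) -/

/-- **STUB 1 — semisimple companion.** Every framed `ℓ`-adic `ρ : Γ_ℚ → GL₇(ℚ̄_ℓ)` that is
Satake–Frobenius compatible with `(π, ι)` at almost all places has a compatible SEMISIMPLE companion
`ρ'` (the semisimplification, framed in a basis adapted to a Jordan–Hölder filtration: block-diagonal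
part of a block-upper-triangular conjugate, so continuous, with the same Frobenius characteristic
polynomials and `ker ρ' ⊇ ker ρ`, hence unramified wherever `ρ` is), and if `ρ'` is irreducible then
so is `ρ` (one Jordan–Hölder factor). Size M: the framed semisimplification lemma the route header
asks a prover to vendor (`FramedRep.semisimplification`). [folklore] -/
theorem stub_semisimpleCompanionIrreducible :
    ∀ (hcpt : isCompact_glFiniteIntegralLevel 7 ℚ) (π : CuspidalAutomorphicRepData 7 ℚ hcpt),
    ∀ (ℓ : ℕ) [Fact ℓ.Prime] (ι : PadicAlgCl ℓ ≃+* ℂ) (ρ : FramedGaloisRep ℚ (PadicAlgCl ℓ) 7),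
      (∀ᶠ v : HeightOneSpectrum (𝓞 ℚ) in Filter.cofinite,
        Summit.Langlands.SatakeFrobCompatibleAt ι π.1 ρ v) →
      ∃ ρ' : FramedGaloisRep ℚ (PadicAlgCl ℓ) 7,
        (∀ᶠ v : HeightOneSpectrum (𝓞 ℚ) in Filter.cofinite,
          Summit.Langlands.SatakeFrobCompatibleAt ι π.1 ρ' v) ∧
        ρ'.toGaloisRep.IsSemisimple ∧ (ρ'.toGaloisRep.IsIrreducible → ρ.toGaloisRep.IsIrreducible) := by
  sorry

/-- **STUB 2 — no abelian line in generic weight** (Dai arXiv:2510.12496 §4.2 case (i) `6+1`,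
with §3; Sen doi:10.2307/1970879; Hui doi:10.1112/jlms.12811 = Dai Thm 2.15; BLGGT
doi:10.4007/annals.2014.179.2.3; Patrikis–Taylor arXiv:1307.1640). For `π` regular, L-algebraic,
cuspidal on `GL₇(𝔸_ℚ)`, essentially self-dual at Satake level, of NON-`G₂`-admissible infinity type:
cofinitely in `ℓ`, no compatible SEMISIMPLE framed avatar has a one-dimensional subrepresentation
(mechanism in the module docstring). [cite: arXiv:2510.12496, Thm 1.1 and §4.2] -/
theorem stub_genericNoLine :
    ∀ (hcpt : isCompact_glFiniteIntegralLevel 7 ℚ) (π : CuspidalAutomorphicRepData 7 ℚ hcpt)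
      (T : InfinityType ℚ 7), π.1.HasInfinityType T → T.IsRegular → T.IsLAlgebraic →
      (∃ (h1 : isCompact_glFiniteIntegralLevel 1 ℚ) (η : CuspidalAutomorphicRepData 1 ℚ h1),
        ∀ᶠ v : HeightOneSpectrum (𝓞 ℚ) in Filter.cofinite, ∀ α : Multiset ℂ,
          π.1.HasSatakeParamAt v α →
            ∃ e : ℂ, η.1.HasSatakeParamAt v {e} ∧ α.map (fun a => a⁻¹) = α.map (fun a => e * a)) →
      (¬ ∀ σ : ℚ →+* ℂ, ∃ c p q : ℂ, (T σ).map ArchWeight.a =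
        {c, c + p, c - p, c + q, c - q, c + (p + q), c - (p + q)}) →
      ∃ S : Finset ℕ, ∀ (ℓ : ℕ) [Fact ℓ.Prime], ℓ ∉ S →
        ∀ (ι : PadicAlgCl ℓ ≃+* ℂ) (ρ : FramedGaloisRep ℚ (PadicAlgCl ℓ) 7),
          (∀ᶠ v : HeightOneSpectrum (𝓞 ℚ) in Filter.cofinite,
            Summit.Langlands.SatakeFrobCompatibleAt ι π.1 ρ v) →
          ρ.toGaloisRep.IsSemisimple →
          ¬ (∃ W : Subrepresentation ρ.toGaloisRep.toRepresentation,
              Module.finrank (PadicAlgCl ℓ) W.toSubmodule = 1) := by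
  sorry

/-- **STUB 3 — no rank-2 / rank-3 piece in generic weight** (Dai arXiv:2510.12496 §4.1 and §4.2
case (ii), with §3 and Prop 2.12; Patrikis–Taylor arXiv:1307.1640; Sen doi:10.2307/1970879). For `π`
as in stub 2: cofinitely in `ℓ`, no compatible SEMISIMPLE framed avatar has a subrepresentation of
dimension 2 or 3 (mechanism in the module docstring: Goursat raises the semisimple rank at a
Lie-irreducible `λ₀` of type `B₃`). [cite: arXiv:2510.12496, Thm 1.1, §3 and §4.2] -/
theorem stub_genericNoSmallPiece :
    ∀ (hcpt : isCompact_glFiniteIntegralLevel 7 ℚ) (π : CuspidalAutomorphicRepData 7 ℚ hcpt)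
      (T : InfinityType ℚ 7), π.1.HasInfinityType T → T.IsRegular → T.IsLAlgebraic →
      (∃ (h1 : isCompact_glFiniteIntegralLevel 1 ℚ) (η : CuspidalAutomorphicRepData 1 ℚ h1),
        ∀ᶠ v : HeightOneSpectrum (𝓞 ℚ) in Filter.cofinite, ∀ α : Multiset ℂ,
          π.1.HasSatakeParamAt v α →
            ∃ e : ℂ, η.1.HasSatakeParamAt v {e} ∧ α.map (fun a => a⁻¹) = α.map (fun a => e * a)) →
      (¬ ∀ σ : ℚ →+* ℂ, ∃ c p q : ℂ, (T σ).map ArchWeight.a =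
        {c, c + p, c - p, c + q, c - q, c + (p + q), c - (p + q)}) →
      ∃ S : Finset ℕ, ∀ (ℓ : ℕ) [Fact ℓ.Prime], ℓ ∉ S →
        ∀ (ι : PadicAlgCl ℓ ≃+* ℂ) (ρ : FramedGaloisRep ℚ (PadicAlgCl ℓ) 7),
          (∀ᶠ v : HeightOneSpectrum (𝓞 ℚ) in Filter.cofinite,
            Summit.Langlands.SatakeFrobCompatibleAt ι π.1 ρ v) →
          ρ.toGaloisRep.IsSemisimple →
          ¬ ((∃ W : Subrepresentation ρ.toGaloisRep.toRepresentation,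
                Module.finrank (PadicAlgCl ℓ) W.toSubmodule = 2) ∨
             (∃ W : Subrepresentation ρ.toGaloisRep.toRepresentation,
                Module.finrank (PadicAlgCl ℓ) W.toSubmodule = 3)) := by
  sorry

/-! ## 2. The stub statements as named `Prop`s (literally their types) -/

namespace _Goal

/-- The statement of `stub_semisimpleCompanionIrreducible`, as a named `Prop`. [folklore] -/
def stub_semisimpleCompanionIrreducible : Prop :=
  type_of% @Summit.Langlands.Langlands.Cruxes.GenericWeightCofinite.Birth.stub_semisimpleCompanionIrreducible

/-- The statement of `stub_genericNoLine`, as a named `Prop`. [folklore] -/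
def stub_genericNoLine : Prop :=
  type_of% @Summit.Langlands.Langlands.Cruxes.GenericWeightCofinite.Birth.stub_genericNoLine

/-- The statement of `stub_genericNoSmallPiece`, as a named `Prop`. [folklore] -/
def stub_genericNoSmallPiece : Prop :=
  type_of% @Summit.Langlands.Langlands.Cruxes.GenericWeightCofinite.Birth.stub_genericNoSmallPiece

end _Goal

/-! ## 3. The composition (kernel-checked, no `sorry`) -/

/-- **`GenericWeightCofinite` from the three stubs.** Exceptional set `S = S₁ ∪ S₂`; for `ℓ ∉ S`
and a compatible framed `ρ`, pass to the compatible semisimple companion `ρ'` (stub 1), split by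
`shapes_of_isSemisimple` (proved), exclude a line (stub 2) and a rank-2/3 piece (stub 3), so `ρ'` is
irreducible, hence `ρ` is. The hypotheses are, verbatim, the statements of the three stubs; the
conclusion is the route decl `Summit.Langlands.Langlands.Theses.G2ShadowRankSeven.GenericWeightCofinite`,
by name. [folklore] -/
theorem GenericWeightCofinite_of (hS : _Goal.stub_semisimpleCompanionIrreducible)
    (hL : _Goal.stub_genericNoLine) (hP : _Goal.stub_genericNoSmallPiece) :
    Summit.Langlands.Langlands.Theses.G2ShadowRankSeven.GenericWeightCofinite := by
  unfold _Goal.stub_semisimpleCompanionIrreducible at hS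
  unfold _Goal.stub_genericNoLine at hL
  unfold _Goal.stub_genericNoSmallPiece at hP
  intro hcpt π T hT hreg halg hdual hgen
  obtain ⟨S₁, hS₁⟩ := hL hcpt π T hT hreg halg hdual hgen
  obtain ⟨S₂, hS₂⟩ := hP hcpt π T hT hreg halg hdual hgen
  refine ⟨S₁ ∪ S₂, ?_⟩
  intro ℓ _ hℓ ι ρ hρ
  have hℓ₁ : ℓ ∉ S₁ := fun h => hℓ (Finset.mem_union_left _ h)
  have hℓ₂ : ℓ ∉ S₂ := fun h => hℓ (Finset.mem_union_right _ h)
  obtain ⟨ρ', hρ', hss, himp⟩ := hS hcpt π ℓ ι ρ hρ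
  apply himp
  have h7 : Module.finrank (PadicAlgCl ℓ) (Fin 7 → PadicAlgCl ℓ) = 7 := Module.finrank_fin_fun _
  rcases shapes_of_isSemisimple ρ'.toGaloisRep.toRepresentation h7 hss with
    h | ⟨W, hW⟩ | ⟨W, hW⟩ | ⟨W, hW⟩
  · exact h
  · exact absurd ⟨W, hW⟩ (hS₁ ℓ hℓ₁ ι ρ' hρ' hss)
  · exact absurd (Or.inl ⟨W, hW⟩) (hS₂ ℓ hℓ₂ ι ρ' hρ' hss)
  · exact absurd (Or.inr ⟨W, hW⟩) (hS₂ ℓ hℓ₂ ι ρ' hρ' hss)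

/-- By-name sanity check (an `example`, not a declaration): the three registered stubs feed the
composition and yield the crux decl. -/
example : Summit.Langlands.Langlands.Theses.G2ShadowRankSeven.GenericWeightCofinite :=
  GenericWeightCofinite_of stub_semisimpleCompanionIrreducible stub_genericNoLine
    stub_genericNoSmallPiece

end Summit.Langlands.Langlands.Cruxes.GenericWeightCofinite.Birth

end
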